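import Literature.NumberTheory.EllipticCurves.LocalKernelOfReductionDivisibleThreeProofs
import Literature.NumberTheory.EllipticCurves.TorsionFilAtCyclicOfOrdinaryPointProofs
import Literature.NumberTheory.EllipticCurves.TorsionFilAtAdaptedBasisProofs
import Literature.NumberTheory.EllipticCurves.TorsionCardinality
import Literature.NumberTheory.EllipticCurves.ZpExtensionEisensteinDVRSetting
import HarnessLib

/-!
# `#Fil_v E[3^k] = 3^k` and a basis of `E[3^k]` adapted to `Fil_v` at a place `v ∣ 3` of MULTIPLICATIVE reduction
# (theorems only; no definition, no named fact, no instance, no `sorry`)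

Topic `NumberTheory/EllipticCurves` (LEAD `bsd-wall-utd-p1`, crux r205 stmt-BirchSwinnertonDyer-24737, line `beta-road`, stub
`stub_howardOutputsOfFamily`, E2 unit at `v ∣ 3`).  Cell x9's `exists_generator_torsionFilAt_addOrderOf_eq` and
`exists_addEquiv_mem_torsionFilAt_iff` (`TorsionFilAtAdaptedBasisProofs`: `Fil_v E[p^j] = ℤ · P` with `P` of order EXACTLY `p^j`, and
the adapted basis `e : E[p^j] ≃ (ℤ/p^j)²`, `x ∈ Fil_v ↔ e(x)₁ = 0` — the datum of the (Exact)/coordinate files at `v ∣ p`) assume GOOD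
reduction with an ordinary point.  Here the same statements at a place `v ∋ 3` of MULTIPLICATIVE reduction:

* §1 `exists_three_torsion_one_lt_val` — over an algebraically closed valued field with `0 < |3| < 1` and `|b₂| = 1` (height one),
  `E₁` contains a point of order `3` (`ΨSq₃/9` is monic of degree `8` with `|coeff 6| = |b₂² + 18 b₄|/|9| > 1`, so it has a root of
  absolute value `> 1`, `KernelReductionDivisibleThreeProofs.exists_root_one_lt_val_of_monic`);
* §2 `exists_ne_zero_mem_torsionFilAt_three_of_hasMultiplicativeReductionAt_three` — `Fil_v E[3] ≠ 0` (for the Tate curve: `μ₃ ⊂ E[3]`);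
* §3 `natCard_torsionFilAt_three_eq_…` (`#Fil_v E[3] = 3`) and `natCard_torsionFilAt_pow_eq_…` (`#Fil_v E[3^k] = 3^k`, induction on `k`
  along the onto map `×3 : Fil_v E[3^{k+1}] → Fil_v E[3^k]` of `LocalKernelOfReductionDivisibleThreeProofs`, whose kernel is `Fil_v E[3]`);
* §4 `exists_generator_torsionFilAt_addOrderOf_eq_of_hasMultiplicativeReductionAt_three` and
  `exists_addEquiv_mem_torsionFilAt_iff_of_hasMultiplicativeReductionAt_three` — x9's two statements verbatim at multiplicative `v ∋ 3`.

References: J. H. Silverman, AEC (2009), Ex. 3.7, Prop. VII.2.2, Thm. C.14.1 [SilvermanAEC2009]; R. Greenberg, LNM 1716 (1999), §2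
p. 82 [GreenbergLNM1716]; B. Howard, Compos. Math. 140 (2004), §3.1 [Howard2004HeegnerKolyvagin].  BSD is not proved by any of this.
-/

noncomputable section

open scoped NNReal Classical ContRepresentation
open Polynomial

universe u

/-! ## §1 A `3`-torsion point in `E₁` over a valued field (height one) -/

namespace Literature.NumberTheory.EllipticCurves

open WeierstrassCurve

variable {L : Type u} [Field L] {w : Valuation L ℝ≥0}

/-- **Height one at `3` ⟹ `E₁[3] ≠ 0`**: over an algebraically closed valued field `(L, |·|)` with `0 < |3| < 1`, an integral elliptic
equation with `|b₂| = 1` has a point `(x, y)` of order `3` with `|x| > 1` (the polynomial `ΨSq₃/9`, monic of degree `8`, has the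
coefficient `(b₂² + 18 b₄)/9` of absolute value `> 1`, hence a root of absolute value `> 1`; for the Tate curve this is `μ₃ ⊂ E[3]`).
[cite: SilvermanAEC2009, Exercise 3.7(d),(f) and Prop. VII.2.2] -/
theorem exists_three_torsion_one_lt_val [IsAlgClosed L] {V : WeierstrassCurve L} [hV : V.IsIntegral w.integer] [V.IsElliptic]
    (h3ne : (3 : L) ≠ 0) (h3 : w (3 : L) < 1) (hb₂ : w V.b₂ = 1) :
    ∃ (x y : L) (h : V.toAffine.Nonsingular x y),
      1 < w x ∧ (3 : ℤ) • (WeierstrassCurve.Affine.Point.some x y h : V.toAffine.Point) = 0 := by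
  have h3L : ((3 : ℤ) : L) ≠ 0 := by exact_mod_cast h3ne
  have h9 : (9 : L) ≠ 0 := by
    rw [show (9 : L) = 3 * 3 by norm_num]; exact mul_ne_zero h3ne h3ne
  have hnat : (V.ΨSq 3).natDegree = 8 := by rw [V.natDegree_ΨSq h3L]; rfl
  have hlead : (V.ΨSq 3).leadingCoeff = 9 := by rw [V.leadingCoeff_ΨSq h3L]; norm_num
  -- `G = ΨSq₃ / 9`, monic of degree `8`
  set G : L[X] := C (9 : L)⁻¹ * V.ΨSq 3 with hGdef
  have hGmonic : G.Monic := by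
    rw [Monic, hGdef, leadingCoeff_mul, leadingCoeff_C, hlead, inv_mul_cancel₀ h9]
  have hGnat : G.natDegree = 8 := by
    rw [hGdef, natDegree_mul (by simpa using h9) (V.ΨSq_ne_zero h3L), natDegree_C, zero_add, hnat]
  have hG6 : 1 < w (G.coeff 6) := by
    have h3pos : 0 < w 3 := zero_lt_iff.mpr ((Valuation.ne_zero_iff w).mpr h3ne)
    rw [hGdef, coeff_C_mul, map_mul, val_coeff_six_ΨSq_three h3 hb₂, mul_one, map_inv₀,
      show (9 : L) = 3 * 3 by norm_num, map_mul, one_lt_inv₀ (mul_pos h3pos h3pos)]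
    calc w 3 * w 3 < 1 * 1 := mul_lt_mul'' h3 h3 zero_le zero_le
      _ = 1 := one_mul 1
  obtain ⟨x, hroot, hx⟩ := exists_root_one_lt_val_of_monic hGmonic (by rw [hGnat]; norm_num) hG6
  have hΨ : (V.ΨSq 3).eval x = 0 := by
    have h0 := hroot.eq_zero
    rw [hGdef, eval_mul, eval_C, mul_eq_zero] at h0
    exact h0.resolve_left (inv_ne_zero h9)
  -- an ordinate `y` over `x`
  obtain ⟨y, hy⟩ : ∃ y, V.toAffine.Equation x y := by
    obtain ⟨y, hy⟩ := IsAlgClosed.exists_root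
      (C 1 * X ^ 2 + C (V.a₁ * x + V.a₃) * X + C (-(x ^ 3 + V.a₂ * x ^ 2 + V.a₄ * x + V.a₆)))
      (by rw [degree_quadratic one_ne_zero]; exact two_ne_zero)
    refine ⟨y, (WeierstrassCurve.Affine.equation_iff ..).mpr ?_⟩
    have e : y ^ 2 + (V.a₁ * x + V.a₃) * y - (x ^ 3 + V.a₂ * x ^ 2 + V.a₄ * x + V.a₆) = 0 := by
      have := hy
      simp only [IsRoot.def, eval_add, eval_mul, eval_C, eval_pow, eval_X, one_mul] at this
      linear_combination this
    linear_combination e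
  have hP : V.toAffine.Nonsingular x y := WeierstrassCurve.Affine.equation_iff_nonsingular.mp hy
  exact ⟨x, y, hP, hx, (V.zsmul_some_eq_zero_iff_eval_ΨSq hP 3).mpr hΨ⟩

end Literature.NumberTheory.EllipticCurves

/-! ## §2 `Fil_v E[3] ≠ 0` at a multiplicative place `v ∋ 3` -/

open NumberField IsDedekindDomain Field

namespace WeierstrassCurve

open Literature.NumberTheory.EllipticCurves Literature.NumberTheory.GaloisRepresentations
  IsDedekindDomain.HeightOneSpectrum AddSubgroup

variable {K : Type} [Field K] [NumberField K] (W : WeierstrassCurve K) [W.IsElliptic]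
  (v : HeightOneSpectrum (𝓞 K))

/-- The spectral set-up at a multiplicative place `v ∋ 3`: the generic fibre of the minimal model over `K̄_v` is integral for the
spectral valuation and elliptic, `0 < |3|_v < 1`, and `|b₂|_v = 1`. [folklore] -/
private theorem spectral_setup_of_hasMultiplicativeReductionAt_three (h3v : ((3 : ℕ) : 𝓞 K) ∈ v.asIdeal)
    (hmult : W.HasMultiplicativeReductionAt v) :
    (((W.localMinimalIntegralModel v).map
      (algebraMap (v.adicCompletionIntegers K) (v.adicCompletion K))).baseChange
        (AlgebraicClosure (v.adicCompletion K))).IsIntegral (v.spectralValuation).integer ∧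
    (((W.localMinimalIntegralModel v).map
      (algebraMap (v.adicCompletionIntegers K) (v.adicCompletion K))).baseChange
        (AlgebraicClosure (v.adicCompletion K))).IsElliptic ∧
    (3 : AlgebraicClosure (v.adicCompletion K)) ≠ 0 ∧
    v.spectralValuation (3 : AlgebraicClosure (v.adicCompletion K)) < 1 ∧
    v.spectralValuation (((W.localMinimalIntegralModel v).map
      (algebraMap (v.adicCompletionIntegers K) (v.adicCompletion K))).baseChange
        (AlgebraicClosure (v.adicCompletion K))).b₂ = 1 := by
  have hw := coe_spectralValuation v
  have hX : (W.localMinimalIntegralModel v).map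
      (algebraMap (v.adicCompletionIntegers K) (v.adicCompletion K)) = W.localMinimalModel v :=
    baseChange_integralModel_eq (v.adicCompletionIntegers K) (W.localMinimalModel v)
  haveI : CharZero (v.adicCompletion K) := charZero_of_injective_algebraMap (algebraMap K _).injective
  refine ⟨isIntegral_spectralValuation_baseChange hw (W.localMinimalIntegralModel v), ?_, three_ne_zero, ?_, ?_⟩
  · haveI := W.isElliptic_localMinimalModel v
    rw [hX]; infer_instance
  · have h3mem : (3 : v.adicCompletionIntegers K) ∈ IsLocalRing.maximalIdeal (v.adicCompletionIntegers K) := by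
      have h := (algebraMap_mem_maximalIdeal_adicCompletionIntegers_iff (v := v) ((3 : ℕ) : 𝓞 K)).mpr h3v
      simpa only [map_natCast, Nat.cast_ofNat, map_ofNat] using h
    have hcoe : ((3 : v.adicCompletionIntegers K) : v.adicCompletion K) = 3 := by norm_cast
    have e : (3 : AlgebraicClosure (v.adicCompletion K)) =
        algebraMap (v.adicCompletion K) _ ((3 : v.adicCompletionIntegers K) : v.adicCompletion K) := by
      rw [hcoe, map_ofNat]
    rw [e, ← NNReal.coe_lt_coe, coe_spectralValuation_algebraMap hw, NNReal.coe_one,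
      Valued.toNormedField.norm_lt_one_iff]
    exact mem_maximalIdeal_adicCompletionIntegers_iff.mp h3mem
  · have hb₂unit : IsUnit (W.localMinimalIntegralModel v).b₂ := by
      by_contra hnu
      have hmem : (W.localMinimalIntegralModel v).b₂ ∈ IsLocalRing.maximalIdeal (v.adicCompletionIntegers K) :=
        (IsLocalRing.mem_maximalIdeal _).mpr hnu
      apply W.reductionAt_b₂_ne_zero_of_hasMultiplicativeReductionAt_three v h3v hmult
      rw [reductionAt_eq_map_residue, map_b₂]
      exact (IsLocalRing.residue_eq_zero_iff _).mpr hmem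
    rw [baseChange, map_b₂, map_b₂]
    exact spectralValuation_eq_one_of_isUnit hw hb₂unit

/-- **`E₁(K̄_v)[3] ≠ 0` at a place `v ∋ 3` of multiplicative reduction** (local form): a local point of order `3` inside the kernel of
reduction (for the Tate curve, a primitive cube root of unity). [cite: SilvermanAEC2009, Exercise 3.7(d) and Thm. C.14.1] -/
theorem exists_ne_zero_mem_localKernelOfReduction_three_of_hasMultiplicativeReductionAt_three
    (h3v : ((3 : ℕ) : 𝓞 K) ∈ v.asIdeal) (hmult : W.HasMultiplicativeReductionAt v) :
    ∃ Q : localPoints W (v.adicCompletion K), Q ∈ W.localKernelOfReduction v ∧ Q ≠ 0 ∧ ((3 : ℕ) : ℤ) • Q = 0 := by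
  obtain ⟨hint, hell, h3ne, h3, hb₂⟩ := W.spectral_setup_of_hasMultiplicativeReductionAt_three v h3v hmult
  haveI := hint
  haveI := hell
  obtain ⟨x, y, hxy, hx, h3P⟩ := exists_three_torsion_one_lt_val (w := v.spectralValuation) h3ne h3 hb₂
  set T := W.localPointsEquivModel v with hT
  refine ⟨T.symm (.some x y hxy), (W.mem_localKernelOfReduction_iff_of_eq_some v (T.apply_symm_apply _)).mpr hx, ?_, ?_⟩
  · intro h0
    have h := congrArg T h0
    rw [AddEquiv.apply_symm_apply, map_zero] at h
    exact Affine.Point.some_ne_zero hxy h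
  · apply T.injective
    rw [map_zsmul, AddEquiv.apply_symm_apply, map_zero]
    exact h3P

/-- **`Fil_v E[3] ≠ 0` at a place `v ∋ 3` of multiplicative reduction**: a non-zero algebraic `3`-torsion point in `E₁(K̄_v)`.
[cite: SilvermanAEC2009, Exercise 3.7(d), Thm. C.14.1 and Cor. III.6.4] [cite: GreenbergLNM1716, §2 p. 82] -/
theorem exists_ne_zero_mem_torsionFilAt_three_of_hasMultiplicativeReductionAt_three
    (h3v : ((3 : ℕ) : 𝓞 K) ∈ v.asIdeal) (hmult : W.HasMultiplicativeReductionAt v) :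
    ∃ P : geomTorsion W ((3 : ℕ) : ℤ), P ∈ W.torsionFilAt v ((3 : ℕ) : ℤ) ∧ P ≠ 0 := by
  obtain ⟨Q, hQ, hQne, h3Q⟩ :=
    W.exists_ne_zero_mem_localKernelOfReduction_three_of_hasMultiplicativeReductionAt_three v h3v hmult
  have htor : (3 ^ 1) • Q = 0 := by rw [pow_one, ← natCast_zsmul]; exact h3Q
  obtain ⟨P, hP, hPQ⟩ := exists_pointsMapOfEmb_eq_of_nsmul_eq_zero W (closureEmb (K := K) (v.adicCompletion K))
    (pow_ne_zero 1 three_ne_zero) htor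
  have hPmem : P ∈ geomTorsion W ((3 : ℕ) : ℤ) := by
    rw [mem_geomTorsion_iff, natCast_zsmul]; rw [pow_one] at hP; exact hP
  refine ⟨⟨P, hPmem⟩, (W.mem_torsionFilAt_iff v _ _).mpr (by rw [hPQ]; exact hQ), fun h0 ↦ hQne ?_⟩
  rw [← hPQ, show (P : geomPoints W) = ((⟨P, hPmem⟩ : geomTorsion W ((3 : ℕ) : ℤ)) : geomPoints W) from rfl, h0,
    ZeroMemClass.coe_zero, map_zero]

/-! ## §3 `#Fil_v E[3] = 3` and `#Fil_v E[3^k] = 3^k` -/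

/-- **`#Fil_v E[3] = 3` at a place `v ∋ 3` of multiplicative reduction** (`≤ 3` by the ordinary point of
`TorsionFilAtCyclicMultiplicativeThreeProofs`, `≠ 1` by §2, and `#Fil_v E[3] ∣ #E[3] = 9`).
[cite: GreenbergLNM1716, §2 p. 82 and Prop. 2.3] [cite: SilvermanAEC2009, Thm. C.14.1] -/
theorem natCard_torsionFilAt_three_eq_of_hasMultiplicativeReductionAt_three
    (h3v : ((3 : ℕ) : 𝓞 K) ∈ v.asIdeal) (hmult : W.HasMultiplicativeReductionAt v) :
    Nat.card (W.torsionFilAt v ((3 : ℕ) : ℤ)) = 3 := by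
  haveI : Fact (Nat.Prime 3) := ⟨Nat.prime_three⟩
  have hle : Nat.card (W.torsionFilAt v ((3 : ℕ) : ℤ)) ≤ 3 :=
    W.natCard_torsionFilAt_prime_le_of_exists_not_mem v
      (W.exists_not_mem_torsionFilAt_of_hasMultiplicativeReductionAt_three v h3v hmult)
  -- `#Fil ∣ #E[3] = 9`
  have h3K : ((3 : ℕ) : K) ≠ 0 := by exact_mod_cast (three_ne_zero : (3 : K) ≠ 0)
  haveI : Finite (geomTorsion W ((3 : ℕ) : ℤ)) := by
    obtain ⟨e⟩ := W.nonempty_geomTorsion_addEquiv_fin_two h3K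
    exact Finite.of_equiv _ e.toEquiv.symm
  have hdvd : Nat.card (W.torsionFilAt v ((3 : ℕ) : ℤ)) ∣ 3 ^ 2 := by
    have h9 : Nat.card (geomTorsion W ((3 : ℕ) : ℤ)) = 3 ^ 2 := by
      obtain ⟨e⟩ := W.nonempty_geomTorsion_addEquiv_fin_two h3K
      rw [Nat.card_congr e.toEquiv, Nat.card_eq_fintype_card, Fintype.card_pi, Finset.prod_const, ZMod.card,
        Finset.card_univ, Fintype.card_fin]
    rw [← h9]
    exact (W.torsionFilAt v ((3 : ℕ) : ℤ)).toAddSubgroup.card_addSubgroup_dvd_card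
  -- `#Fil ≠ 1`
  have hne : Nat.card (W.torsionFilAt v ((3 : ℕ) : ℤ)) ≠ 1 := by
    obtain ⟨P, hP, hPne⟩ := W.exists_ne_zero_mem_torsionFilAt_three_of_hasMultiplicativeReductionAt_three v h3v hmult
    intro h1
    haveI : Finite (W.torsionFilAt v ((3 : ℕ) : ℤ)) := Nat.finite_of_card_ne_zero (by rw [h1]; exact one_ne_zero)
    have hsub := (Nat.card_eq_one_iff_unique.mp h1).1
    exact hPne (congrArg Subtype.val (hsub.elim (⟨P, hP⟩ : W.torsionFilAt v ((3 : ℕ) : ℤ)) ⟨0, zero_mem _⟩))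
  rcases (Nat.dvd_prime_pow Nat.prime_three).mp hdvd with ⟨i, hi, hcard⟩
  interval_cases i
  · exact absurd hcard (by rw [pow_zero]; exact hne)
  · rw [hcard, pow_one]
  · rw [hcard] at hle; norm_num at hle

/-- **`#Fil_v E[3^k] = 3^k` at a place `v ∋ 3` of multiplicative reduction** (induction on `k`: `×3 : Fil_v E[3^{k+1}] → Fil_v E[3^k]`
is onto by `LocalKernelOfReductionDivisibleThreeProofs`, with kernel the points of order `3` of `Fil_v E[3^{k+1}]`, in bijection with
`Fil_v E[3]`). [cite: GreenbergLNM1716, §2 p. 82 (ℱ[p^∞] ≅ ℚ_p/ℤ_p)] [cite: SilvermanAEC2009, Thm. C.14.1] -/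
theorem natCard_torsionFilAt_pow_eq_of_hasMultiplicativeReductionAt_three
    (h3v : ((3 : ℕ) : 𝓞 K) ∈ v.asIdeal) (hmult : W.HasMultiplicativeReductionAt v) (k : ℕ) :
    Nat.card (W.torsionFilAt v (((3 : ℕ) : ℤ) ^ k)) = 3 ^ k := by
  induction k with
  | zero =>
    -- `E[1] = 0`
    rw [pow_zero, pow_zero]
    refine Nat.card_eq_one_iff_unique.mpr ⟨⟨fun a b ↦ Subtype.ext (Subtype.ext ?_)⟩, ⟨⟨0, zero_mem _⟩⟩⟩
    have ha := (mem_geomTorsion_iff W _ _).mp a.1.2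
    have hb := (mem_geomTorsion_iff W _ _).mp b.1.2
    rw [one_zsmul] at ha hb
    rw [ha, hb]
  | succ k ih =>
    -- the map `×3 : Fil_{k+1} → Fil_k`
    have hmap : ∀ y : W.torsionFilAt v (((3 : ℕ) : ℤ) ^ (k + 1)),
        W.geomTorsionReduce 3 k y ∈ W.torsionFilAt v (((3 : ℕ) : ℤ) ^ k) := fun y ↦
      W.geomTorsionReduce_mem_torsionFilAt v 3 k y y.2
    let f : W.torsionFilAt v (((3 : ℕ) : ℤ) ^ (k + 1)) →+ W.torsionFilAt v (((3 : ℕ) : ℤ) ^ k) :=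
      { toFun := fun y ↦ ⟨W.geomTorsionReduce 3 k y, hmap y⟩
        map_zero' := Subtype.ext (map_zero _)
        map_add' := fun a b ↦ Subtype.ext (map_add _ _ _) }
    have hfval : ∀ y, (((f y : W.torsionFilAt v (((3 : ℕ) : ℤ) ^ k)) : geomTorsion W (((3 : ℕ) : ℤ) ^ k)) : geomPoints W) =
        ((3 : ℕ) : ℤ) • (((y : W.torsionFilAt v _) : geomTorsion W (((3 : ℕ) : ℤ) ^ (k + 1))) : geomPoints W) := fun _ ↦ rfl
    -- `f` is onto (`E₁` is `3`-divisible)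
    have hsurj : Function.Surjective f := by
      intro y
      obtain ⟨y', hy', he⟩ := W.exists_mem_torsionFilAt_reduce_eq_of_hasMultiplicativeReductionAt_three v h3v hmult
        (W.torsionGaloisModuleReduce 3) (fun _ _ ↦ rfl) k y y.2
      exact ⟨⟨y', hy'⟩, Subtype.ext he⟩
    -- `#ker f = #Fil_v E[3] = 3`
    have hker : Nat.card f.ker = 3 := by
      refine (Nat.card_congr ?_).trans (W.natCard_torsionFilAt_three_eq_of_hasMultiplicativeReductionAt_three v h3v hmult)
      have h1 : ∀ y : f.ker, (((y : W.torsionFilAt v (((3 : ℕ) : ℤ) ^ (k + 1))) :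
          geomTorsion W (((3 : ℕ) : ℤ) ^ (k + 1))) : geomPoints W) ∈ geomTorsion W ((3 : ℕ) : ℤ) := fun y ↦ by
        rw [mem_geomTorsion_iff, ← hfval, (AddMonoidHom.mem_ker).mp y.2]
        rfl
      have h2 : ∀ y : f.ker, (⟨_, h1 y⟩ : geomTorsion W ((3 : ℕ) : ℤ)) ∈ W.torsionFilAt v ((3 : ℕ) : ℤ) := fun y ↦
        (W.mem_torsionFilAt_iff v _ _).mpr
          ((W.mem_torsionFilAt_iff v _ _).mp (y : W.torsionFilAt v (((3 : ℕ) : ℤ) ^ (k + 1))).2)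
      have h3' : ∀ P : W.torsionFilAt v ((3 : ℕ) : ℤ),
          (((P : geomTorsion W ((3 : ℕ) : ℤ))) : geomPoints W) ∈ geomTorsion W (((3 : ℕ) : ℤ) ^ (k + 1)) := fun P ↦ by
        rw [mem_geomTorsion_iff, pow_succ, ← smul_smul, (mem_geomTorsion_iff W _ _).mp P.1.2, smul_zero]
      have h4 : ∀ P : W.torsionFilAt v ((3 : ℕ) : ℤ),
          (⟨_, h3' P⟩ : geomTorsion W (((3 : ℕ) : ℤ) ^ (k + 1))) ∈ W.torsionFilAt v (((3 : ℕ) : ℤ) ^ (k + 1)) :=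
        fun P ↦ (W.mem_torsionFilAt_iff v _ _).mpr ((W.mem_torsionFilAt_iff v _ _).mp P.2)
      have h5 : ∀ P : W.torsionFilAt v ((3 : ℕ) : ℤ),
          (⟨⟨_, h3' P⟩, h4 P⟩ : W.torsionFilAt v (((3 : ℕ) : ℤ) ^ (k + 1))) ∈ f.ker := fun P ↦ by
        rw [AddMonoidHom.mem_ker]
        refine Subtype.ext (Subtype.ext ?_)
        rw [hfval, ZeroMemClass.coe_zero, ZeroMemClass.coe_zero]
        exact (mem_geomTorsion_iff W _ _).mp P.1.2
      exact ⟨fun y ↦ ⟨⟨_, h1 y⟩, h2 y⟩, fun P ↦ ⟨⟨⟨_, h3' P⟩, h4 P⟩, h5 P⟩, fun y ↦ rfl, fun P ↦ rfl⟩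
    -- count: `#Fil_{k+1} = #(Fil_{k+1}/ker f) · #ker f = #Fil_k · 3`
    haveI : Finite (W.torsionFilAt v (((3 : ℕ) : ℤ) ^ k)) := Nat.finite_of_card_ne_zero (by rw [ih]; positivity)
    have hq : Nat.card (W.torsionFilAt v (((3 : ℕ) : ℤ) ^ (k + 1)) ⧸ f.ker) = Nat.card (W.torsionFilAt v (((3 : ℕ) : ℤ) ^ k)) :=
      Nat.card_congr (QuotientAddGroup.quotientKerEquivOfSurjective f hsurj).toEquiv
    have hcard := f.ker.card_eq_card_quotient_mul_card_addSubgroup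
    rw [hq, ih, hker] at hcard
    rw [hcard, pow_succ]

/-! ## §4 A generator of order `3^k` and the adapted basis -/

/-- **`Fil_v E[3^j] = ℤ · P` with `P` of order exactly `3^j`** at a place `v ∋ 3` of MULTIPLICATIVE reduction — x9's
`exists_generator_torsionFilAt_addOrderOf_eq` (there: good reduction + ordinary point) at the twin's places.
[cite: GreenbergLNM1716, §2 p. 82] [cite: Howard2004HeegnerKolyvagin, §3.1 (arXiv p. 15, L56–62: Fil_v T has rank one)]
[cite: SilvermanAEC2009, Thm. C.14.1] -/
theorem exists_generator_torsionFilAt_addOrderOf_eq_of_hasMultiplicativeReductionAt_three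
    (h3v : ((3 : ℕ) : 𝓞 K) ∈ v.asIdeal) (hmult : W.HasMultiplicativeReductionAt v) (j : ℕ) :
    ∃ P : geomTorsion W (((3 : ℕ) : ℤ) ^ j), P ∈ W.torsionFilAt v (((3 : ℕ) : ℤ) ^ j) ∧ addOrderOf P = 3 ^ j ∧
      ∀ Q ∈ W.torsionFilAt v (((3 : ℕ) : ℤ) ^ j), ∃ c : ℕ, Q = c • P := by
  obtain ⟨P, hP, hgen⟩ := W.exists_generator_torsionFilAt_of_hasMultiplicativeReductionAt_three v h3v hmult j
  -- `Fil_j = ℤ · P` as additive subgroups, hence `addOrderOf P = #Fil_j = 3^j`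
  have heq : (W.torsionFilAt v (((3 : ℕ) : ℤ) ^ j)).toAddSubgroup = AddSubgroup.zmultiples P := by
    refine le_antisymm (fun Q hQ ↦ ?_) (AddSubgroup.zmultiples_le.mpr hP)
    obtain ⟨c, rfl⟩ := hgen Q hQ
    exact AddSubgroup.zsmul_mem_zmultiples P c
  have hord : addOrderOf P = 3 ^ j := by
    rw [← Nat.card_zmultiples P, ← W.natCard_torsionFilAt_pow_eq_of_hasMultiplicativeReductionAt_three v h3v hmult j]
    exact Nat.card_congr (AddEquiv.addSubgroupCongr heq.symm).toEquiv
  have hfin : IsOfFinAddOrder P := by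
    rw [← addOrderOf_pos_iff, hord]; positivity
  refine ⟨P, hP, hord, fun Q hQ ↦ ?_⟩
  have hQ' : Q ∈ AddSubgroup.zmultiples P := by rw [← heq]; exact hQ
  obtain ⟨c, hc⟩ := (hfin.mem_multiples_iff_mem_zmultiples).mpr hQ'
  exact ⟨c, hc.symm⟩

/-- **A basis of `E[3^j]` adapted to `Fil_v E[3^j]`** at a place `v ∋ 3` of MULTIPLICATIVE reduction: `e : E[3^j] ≃ (ℤ/3^j)²` with
`x ∈ Fil_v E[3^j] ↔ e(x)₁ = 0`, `j ≥ 1` — x9's `exists_addEquiv_mem_torsionFilAt_iff` at the twin's places (same proof, with §4's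
generator). [cite: Howard2004HeegnerKolyvagin, H.0 and §3.1 (arXiv p. 7 L57, p. 15 L56–62)] [cite: GreenbergLNM1716, §2] -/
theorem exists_addEquiv_mem_torsionFilAt_iff_of_hasMultiplicativeReductionAt_three
    (h3v : ((3 : ℕ) : 𝓞 K) ∈ v.asIdeal) (hmult : W.HasMultiplicativeReductionAt v) {j : ℕ} (hj : 1 ≤ j) :
    ∃ e : geomTorsion W (((3 : ℕ) : ℤ) ^ j) ≃+ (Fin 2 → ZMod (3 ^ j)),
      ∀ x, x ∈ W.torsionFilAt v (((3 : ℕ) : ℤ) ^ j) ↔ e x 1 = 0 := by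
  haveI : Fact (Nat.Prime 3) := ⟨Nat.prime_three⟩
  haveI : NeZero (3 ^ j) := ⟨pow_ne_zero j three_ne_zero⟩
  have h3K : ((3 : ℕ) : K) ≠ 0 := by exact_mod_cast (three_ne_zero : (3 : K) ≠ 0)
  obtain ⟨e₀⟩ := W.nonempty_geomTorsion_prime_pow_addEquiv_fin_two h3K j
  obtain ⟨P, hPFil, hPord, hgen⟩ :=
    W.exists_generator_torsionFilAt_addOrderOf_eq_of_hasMultiplicativeReductionAt_three v h3v hmult j
  have hv : addOrderOf (e₀ P) = 3 ^ j :=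
    (addOrderOf_injective e₀.toAddMonoidHom e₀.injective P).trans hPord
  obtain ⟨T, hT⟩ := exists_addEquiv_apply_eq_single_of_addOrderOf_eq hj (e₀ P) hv
  refine ⟨e₀.trans T, fun x ↦ ⟨fun hx ↦ ?_, fun hx ↦ ?_⟩⟩
  · obtain ⟨c, rfl⟩ := hgen x hx
    rw [map_nsmul, AddEquiv.trans_apply, hT, Pi.smul_apply, Pi.single_apply, if_neg one_ne_zero, smul_zero]
  · set y := (e₀.trans T) x with hy
    have hxy : (e₀.trans T) x = (e₀.trans T) ((y 0).val • P) := by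
      rw [map_nsmul, AddEquiv.trans_apply e₀ T P, hT, ← hy]
      funext i
      fin_cases i
      · change y 0 = ((y 0).val • (Pi.single 0 1 : Fin 2 → ZMod (3 ^ j))) 0
        rw [Pi.smul_apply, Pi.single_eq_same, nsmul_eq_mul, mul_one, ZMod.natCast_zmod_val]
      · change y 1 = ((y 0).val • (Pi.single 0 1 : Fin 2 → ZMod (3 ^ j))) 1
        rw [Pi.smul_apply, Pi.single_apply, if_neg one_ne_zero, smul_zero]
        exact hx
    rw [(e₀.trans T).injective hxy]
    exact Submodule.smul_of_tower_mem _ (y 0).val hPFil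

end WeierstrassCurve

end
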